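import Literature.NumberTheory.Automorphic.GL2RSLFactorCharacter
import HarnessLib

/-!
# `L(s, π × |·|^t) = L(s + t, π × 1)`: the Rankin–Selberg `L`-factor of `GL_n × GL₁` under an
# unramified twist `|·|^t`, and `L(s, (π ⊗ |det|^t) × 1)` for `GL₂`
# (Jacquet–Langlands 1970, p. 40 and proof of Thm. 11.1, p. 171; JPSS 1983, §2)

Topic `Literature/NumberTheory/Automorphic`; proof file (theorems only: no definition, no named
fact, no instance), vocabulary of `RankinSelbergLocal` (`rsZeta`, `HasRSLFactor`, `glOneRep`,
`evalAtQ`, `IsLaurent`, `EqOnRightHalfPlane`, `rsLRat`).  For a character `χ` of `Fˣ` of the form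
`χ(a) = |a|^t` (`t ∈ ℂ`, `|·| = normAbs F`, the normalised absolute value) the `GL_n × GL₁` zeta
integrals satisfy

  `Ψ(s; W, χ) = Ψ(s + t; W, 1)`   (`rsZeta_glOneRep_eq_rsZeta_trivial_add`: the integrand
  `W(diag(g⁻¹,1)) χ(det g)⁻¹ |det g⁻¹|^{s-(n-1)/2}` is `W(diag(g⁻¹,1)) |det g⁻¹|^{s+t-(n-1)/2}`),

so that `L(s, π × χ) = L(s + t, π × 1)`: in the currency of `HasRSLFactor` (the `L`-factor as the
polynomial `P`, `L = P(q^{-s})⁻¹`),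

  `HasRSLFactor hn π (glOneRep χ) ψ ν (P(q^{-t} X)) ↔ HasRSLFactor hn π 1 ψ ν P`
  (`hasRSLFactor_glOneRep_iff_of_normAbs_cpow`),

the shift `s ↦ s + t` acting on the Laurent polynomials `R ∈ ℂ[X, X⁻¹]` of the definition by
`X ↦ q^{-t} X` (`IsLaurent.exists_shift`).  For `GL₂` the twist form follows from
`hasRSLFactor_glOneRep_iff_twist` (`GL2RSLFactorCharacter`):
`L(s, (π ⊗ χ∘det) × 1) = L(s + t, π × 1)` (`hasRSLFactor_twist_det_iff_of_normAbs_cpow`).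

This is the local half of Jacquet–Langlands' normalisation in the proof of Thm. 11.1 (p. 171 of
the retypeset edition: the cusp forms of `|η(det)|^{-1/2} ⊗ π` are bounded, "`λ'_v` is the
homomorphism associated to `|η_v|^{-1/2} ⊗ π_v`") and of Borel–Jacquet's "`π = π₀ ⊗ χ` with `π₀`
unitary" (1979, 5.7): the local Euler polynomials of `π ⊗ |det|_𝔸^t` are those of `π` rescaled by
`X ↦ q_v^{-t} X`, i.e. `L(s, π ⊗ |det|^t) = L(s + t, π)`.

## Main results

* `IsLaurent.exists_shift`, `evalAtQ_rsLRat_comp_C_mul_X`, `IsLaurent.exists_shift_mul_rsLRat` —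
  the shift `s ↦ s + t` on `ℂ[X, X⁻¹]` and on `R / P`.
* `rsZeta_glOneRep_eq_rsZeta_trivial_add` — `Ψ(s; W, |·|^t) = Ψ(s + t; W, 1)` (`GL_n × GL₁`).
* `HasRSLFactor.of_rsZeta_eq_add` — transport of `HasRSLFactor` along a shift of all zeta
  integrals (`P ↦ P(q^{-t} X)`).
* `hasRSLFactor_glOneRep_iff_of_normAbs_cpow` (`GL_n × GL₁`),
  `hasRSLFactor_twist_det_iff_of_normAbs_cpow` (`GL₂`, twist by `|det|^t`).

## References

* H. Jacquet, R. P. Langlands, *Automorphic Forms on GL(2)*, LNM 114 (1970), p. 40 (the factor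
  `L(s, χ ⊗ π)`), proof of Thm. 11.1, p. 171. [JacquetLanglands1970]
* H. Jacquet, I. I. Piatetski-Shapiro, J. Shalika, *Rankin–Selberg convolutions*, Amer. J. Math.
  105 (1983), §2.4, Thm. 2.7 (i)–(ii). [JacquetPiatetskiShapiroShalika1983]
* A. Borel, H. Jacquet, *Automorphic forms and automorphic representations*, Proc. Sympos. Pure
  Math. 33.1 (1979), 5.7. [BorelJacquetCorvallis1979]
-/

noncomputable section

open scoped MatrixGroups NNReal Polynomial
open MeasureTheory ValuativeRel Polynomial Filter
  Literature.NumberTheory.GaloisRepresentations.IsNonarchimedeanLocalField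
  Literature.RepresentationTheory.Semisimple

namespace Literature.NumberTheory.Automorphic

/-! ### Part 1: the shift `s ↦ s + t` on Laurent polynomials and on `R / P` -/

section Shift

/-- `P(aX)(bX) = P(abX)`. [folklore] -/
theorem comp_C_mul_X_comp_C_mul_X (P : ℂ[X]) (a b : ℂ) :
    (P.comp (C a * X)).comp (C b * X) = P.comp (C (a * b) * X) := by
  rw [Polynomial.comp_assoc, mul_comp, C_comp, X_comp, ← mul_assoc, ← C_mul]

/-- `q^{-t} q^{-s} = q^{-(s + t)}`. [folklore] -/
private theorem rsShift_qpow_mul_qpow {q : ℕ} (hq : 0 < q) (s t : ℂ) :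
    (q : ℂ) ^ (-t) * (q : ℂ) ^ (-s) = (q : ℂ) ^ (-(s + t)) := by
  rw [← Complex.cpow_add _ _ (Nat.cast_ne_zero.2 (Nat.pos_iff_ne_zero.1 hq))]
  congr 1
  ring

/-- `q^{-t} q^{-(-t)} = 1`. [folklore] -/
private theorem rsShift_qpow_mul_qpow_neg {q : ℕ} (hq : 0 < q) (t : ℂ) :
    (q : ℂ) ^ (-t) * (q : ℂ) ^ (-(-t)) = 1 := by
  rw [← Complex.cpow_add _ _ (Nat.cast_ne_zero.2 (Nat.pos_iff_ne_zero.1 hq)), neg_neg,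
    neg_add_cancel, Complex.cpow_zero]

/-- An eventual property along `rightHalfPlanes` stays eventual after the shift `s ↦ s + t`.
[folklore] -/
theorem eventually_rightHalfPlanes_add {p : ℂ → Prop} (h : ∀ᶠ s in rightHalfPlanes, p s) (t : ℂ) :
    ∀ᶠ s in rightHalfPlanes, p (s + t) := by
  obtain ⟨c, hc⟩ := eventually_rightHalfPlanes_iff.1 h
  exact eventually_rightHalfPlanes_iff.2 ⟨c - t.re, fun s hs => hc _ (by rw [Complex.add_re]; linarith)⟩

/-- **The shift on Laurent polynomials**: for `Q ∈ ℂ[X, X⁻¹]` and `t ∈ ℂ` there is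
`Q' ∈ ℂ[X, X⁻¹]` with `Q'(q^{-s}) = Q(q^{-(s+t)})` for all `s` (`Q = Q₀ / X^k` ↦
`q^{tk} Q₀(q^{-t} X) / X^k`). [folklore] -/
theorem IsLaurent.exists_shift {q : ℕ} (hq : 0 < q) {Q : RatFunc ℂ} (hQ : IsLaurent Q) (t : ℂ) :
    ∃ Q' : RatFunc ℂ, IsLaurent Q' ∧ ∀ s : ℂ, evalAtQ q Q' s = evalAtQ q Q (s + t) := by
  obtain ⟨Q₀, k, rfl⟩ := hQ
  have hev : ∀ (P₁ : ℂ[X]) (a x : ℂ), (P₁.comp (C a * X)).eval x = P₁.eval (a * x) :=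
    fun P₁ a x => by rw [eval_comp, eval_mul, eval_C, eval_X]
  have ha0 : (q : ℂ) ^ (-t) ≠ 0 := natCast_cpow_neg_ne_zero hq t
  refine ⟨algebraMap ℂ[X] (RatFunc ℂ) (C (((q : ℂ) ^ (-t))⁻¹ ^ k) * Q₀.comp (C ((q : ℂ) ^ (-t)) * X)) /
      RatFunc.X ^ k, ⟨_, _, rfl⟩, fun s => ?_⟩
  have hx : (q : ℂ) ^ (-s) ≠ 0 := natCast_cpow_neg_ne_zero hq s
  have hXk : (RatFunc.X : RatFunc ℂ) ^ k = algebraMap ℂ[X] (RatFunc ℂ) (X ^ k) := by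
    rw [map_pow, RatFunc.algebraMap_X]
  have hy : (q : ℂ) ^ (-(s + t)) ≠ 0 := natCast_cpow_neg_ne_zero hq (s + t)
  rw [hXk, evalAtQ_div_of_eval_ne_zero _ _ _ (by rw [eval_pow, eval_X]; exact pow_ne_zero _ hx),
    evalAtQ_div_of_eval_ne_zero _ _ _ (by rw [eval_pow, eval_X]; exact pow_ne_zero _ hy),
    eval_mul, eval_C, hev, eval_pow, eval_X, eval_pow, eval_X,
    ← rsShift_qpow_mul_qpow hq s t, mul_pow, inv_pow, div_eq_div_iff (pow_ne_zero _ hx)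
      (mul_ne_zero (pow_ne_zero _ ha0) (pow_ne_zero _ hx))]
  field_simp

/-- **The shift on `1 / P`**: `(1/P(q^{-t}X))(q^{-s}) = (1/P)(q^{-(s+t)})` off the zeros of `P`.
[folklore] -/
theorem evalAtQ_rsLRat_comp_C_mul_X {q : ℕ} (hq : 0 < q) (P : ℂ[X]) (t s : ℂ)
    (hP : P.eval ((q : ℂ) ^ (-(s + t))) ≠ 0) :
    evalAtQ q (rsLRat (P.comp (C ((q : ℂ) ^ (-t)) * X))) s = evalAtQ q (rsLRat P) (s + t) := by
  have hev : ∀ (P₁ : ℂ[X]) (a x : ℂ), (P₁.comp (C a * X)).eval x = P₁.eval (a * x) :=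
    fun P₁ a x => by rw [eval_comp, eval_mul, eval_C, eval_X]
  have h1 : ∀ R : ℂ[X], rsLRat R =
      algebraMap ℂ[X] (RatFunc ℂ) 1 / algebraMap ℂ[X] (RatFunc ℂ) R := fun R => by
    rw [rsLRat, map_one, one_div]
  have hPt : (P.comp (C ((q : ℂ) ^ (-t)) * X)).eval ((q : ℂ) ^ (-s)) ≠ 0 := by
    rwa [hev, rsShift_qpow_mul_qpow hq]
  rw [h1, h1, evalAtQ_div_of_eval_ne_zero _ _ _ hPt, evalAtQ_div_of_eval_ne_zero _ _ _ hP,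
    eval_one, eval_one, hev, rsShift_qpow_mul_qpow hq]

/-- **The shift on `R / P`**: for `R ∈ ℂ[X, X⁻¹]`, `P ≠ 0` and `t ∈ ℂ` there is `R' ∈ ℂ[X, X⁻¹]`
with `(R' / P(q^{-t}X))(q^{-s}) = (R / P)(q^{-(s+t)})` for `re s` large. [folklore] -/
theorem IsLaurent.exists_shift_mul_rsLRat {q : ℕ} (hq : 1 < q) {R : RatFunc ℂ} (hR : IsLaurent R)
    {P : ℂ[X]} (hP0 : P ≠ 0) (t : ℂ) :
    ∃ R' : RatFunc ℂ, IsLaurent R' ∧ ∃ c : ℝ, ∀ s : ℂ, c < s.re →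
      evalAtQ q (R' * rsLRat (P.comp (C ((q : ℂ) ^ (-t)) * X))) s =
        evalAtQ q (R * rsLRat P) (s + t) := by
  have hq0 : 0 < q := zero_lt_one.trans hq
  obtain ⟨R', hR', hRR'⟩ := hR.exists_shift hq0 t
  refine ⟨R', hR', ?_⟩
  have h1 := eventually_evalAtQ_mul hq R' (rsLRat (P.comp (C ((q : ℂ) ^ (-t)) * X)))
  have h2 := eventually_rightHalfPlanes_add (eventually_evalAtQ_mul hq R (rsLRat P)) t
  have h3 := eventually_rightHalfPlanes_add (eventually_eval_qpow_ne_zero hq hP0) t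
  obtain ⟨c, hc⟩ := eventually_rightHalfPlanes_iff.1 (h1.and (h2.and h3))
  refine ⟨c, fun s hs => ?_⟩
  obtain ⟨e1, e2, e3⟩ := hc s hs
  rw [e1, e2, hRR', evalAtQ_rsLRat_comp_C_mul_X hq0 P t s e3]

end Shift

/-! ### Part 2: `Ψ(s; W, |·|^t) = Ψ(s + t; W, 1)` and the transport of `HasRSLFactor` -/

section Local

variable {F : Type*} [Field F] [ValuativeRel F] [TopologicalSpace F] [IsNonarchimedeanLocalField F]
  {n : ℕ}

/-- `χ(a)⁻¹ = |a⁻¹|^t` for `χ = |·|^t`. [folklore] -/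
theorem inv_eq_normAbs_inv_cpow {χ : Fˣ →* ℂˣ} {t : ℂ}
    (hχ : ∀ a : Fˣ, ((χ a : ℂˣ) : ℂ) = (((normAbs F (a : F) : ℝ≥0) : ℝ) : ℂ) ^ t) (a : Fˣ) :
    ((χ a : ℂˣ) : ℂ)⁻¹ = (((normAbs F ((a⁻¹ : Fˣ) : F) : ℝ≥0) : ℝ) : ℂ) ^ t := by
  rw [← Units.val_inv_eq_inv_val, ← map_inv, hχ]

variable [MeasurableSpace (GL (Fin 1) F ⧸ upperUnitriangular (Fin 1) F)]

/-- **`Ψ(s; W, |·|^t) = Ψ(s + t; W, 1)`** for the `GL_n × GL₁` zeta integrals: if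
`χ(a) = |a|^t`, the integrand `W(diag(g⁻¹, 1)) χ(det g)⁻¹ Λ'(v') |det g⁻¹|^{s - (n-1)/2}` of
`Ψ(s; W, W'_{v'})`, `W' ∈ 𝒲(glOneRep χ)`, is the integrand of `Ψ(s + t; W, Λ'(v'))` for the trivial
representation of `GL₁` (Jacquet–Langlands 1970, p. 40: `L(s, χ ⊗ π)` from `χ(a) W(d(a,1))`).
[cite: JacquetLanglands1970, Thm. 2.18 and p. 40] -/
theorem rsZeta_glOneRep_eq_rsZeta_trivial_add (hn : 1 < n)
    (ν : Measure (GL (Fin 1) F ⧸ upperUnitriangular (Fin 1) F)) {χ : Fˣ →* ℂˣ} {t : ℂ}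
    (hχ : ∀ a : Fˣ, ((χ a : ℂˣ) : ℂ) = (((normAbs F (a : F) : ℝ≥0) : ℝ) : ℂ) ^ t)
    (W : GL (Fin n) F → ℂ) (Λ' : Module.Dual ℂ ℂ) (v' : ℂ) (s : ℂ) :
    rsZeta hn ν W (whittakerModel (glOneRep χ) Λ' v') s =
      rsZeta hn ν W (whittakerModel (Representation.trivial ℂ (GL (Fin 1) F) ℂ) Λ' v') (s + t) := by
  have hint : rsIntegrand hn W (whittakerModel (glOneRep χ) Λ' v') s =
      rsIntegrand hn W (whittakerModel (Representation.trivial ℂ (GL (Fin 1) F) ℂ) Λ' v') (s + t) := by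
    funext g
    have h0 : (((normAbs F ((Matrix.GeneralLinearGroup.det g⁻¹ : Fˣ) : F) : ℝ≥0) : ℝ) : ℂ) ≠ 0 := by
      rw [Ne, Complex.ofReal_eq_zero, NNReal.coe_eq_zero, map_eq_zero]
      exact Units.ne_zero _
    rw [rsIntegrand_whittakerModel_glOneRep, rsIntegrand, whittakerModel_trivial_apply,
      inv_eq_normAbs_inv_cpow hχ, ← map_inv, Nat.cast_one,
      show s + t - ((n : ℂ) - 1) / 2 = t + (s - ((n : ℂ) - 1) / 2) by ring,
      Complex.cpow_add _ _ h0]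
    ring
  have hker : rsKernel hn W (whittakerModel (glOneRep χ) Λ' v') s =
      rsKernel hn W (whittakerModel (Representation.trivial ℂ (GL (Fin 1) F) ℂ) Λ' v') (s + t) := by
    funext x
    induction x using QuotientGroup.induction_on with
    | H g => rw [rsKernel_mk_of_fin_one, rsKernel_mk_of_fin_one, hint]
  rw [rsZeta, rsZeta, hker]

/-- **Transport of `HasRSLFactor` along a shift of the zeta integrals.** Let `π₁, π₂` be
representations of `GL₁(F)` on the same space with `Ψ(s; W, W'^{π₂}) = Ψ(s + t; W, W'^{π₁})` for
all Whittaker data.  If `P` is an `L`-polynomial of `(π, π₁)` then `P(q^{-t} X)` is an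
`L`-polynomial of `(π, π₂)`: the Laurent coefficients are shifted by `IsLaurent.exists_shift`
(all linear forms on a representation of `GL₁` are Whittaker functionals,
`whittakerFunctionals_eq_top_of_fin_one`). [folklore] -/
theorem HasRSLFactor.of_rsZeta_eq_add (hn : 1 < n) {V : Type*} [AddCommGroup V] [Module ℂ V]
    {π : Representation ℂ (GL (Fin n) F) V} {V' : Type*} [AddCommGroup V'] [Module ℂ V']
    {π₁ π₂ : Representation ℂ (GL (Fin 1) F) V'} {ψ : AddChar F Circle}
    {ν : Measure (GL (Fin 1) F ⧸ upperUnitriangular (Fin 1) F)} {t : ℂ}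
    (hZ : ∀ (W : GL (Fin n) F → ℂ) (Λ' : Module.Dual ℂ V') (v' : V') (s : ℂ),
      rsZeta hn ν W (whittakerModel π₂ Λ' v') s = rsZeta hn ν W (whittakerModel π₁ Λ' v') (s + t))
    {P : ℂ[X]} (h : HasRSLFactor hn π π₁ ψ ν P) :
    HasRSLFactor hn π π₂ ψ ν (P.comp (C (((residueFieldCard F : ℕ) : ℂ) ^ (-t)) * X)) := by
  have hq : 1 < residueFieldCard F := one_lt_residueFieldCard F
  have hq0 : 0 < residueFieldCard F := zero_lt_one.trans hq
  rcases h with ⟨hP1, ha, hb⟩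
  obtain ⟨k, Λ, Λ', v, v', Q, hΛ, -, hQ, c₀, hc₀⟩ := hb
  have hP0 : P ≠ 0 := by
    intro h0
    rw [h0, Polynomial.eval_zero] at hP1
    exact zero_ne_one hP1
  refine ⟨by rw [eval_comp, eval_mul, eval_C, eval_X, mul_zero, hP1], fun Λ₀ hΛ₀ Λ'₀ _ v₀ v'₀ => ?_, ?_⟩
  · -- (a) every zeta integral is `R'(q^{-s}) / P(q^{-t} q^{-s})` for `re s` large
    obtain ⟨R, hR, c₁, hc₁⟩ := ha Λ₀ hΛ₀ Λ'₀
      (by rw [whittakerFunctionals_eq_top_of_fin_one]; exact Submodule.mem_top) v₀ v'₀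
    obtain ⟨R', hR', c₂, hc₂⟩ := hR.exists_shift_mul_rsLRat hq hP0 t
    refine ⟨R', hR', max c₂ (c₁ - t.re), fun s hs => ?_⟩
    have hs₁ : c₁ < (s + t).re := by
      rw [Complex.add_re]
      linarith [le_max_right c₂ (c₁ - t.re)]
    rw [hZ, hc₁ (s + t) hs₁, hc₂ s ((le_max_left _ _).trans_lt hs)]
  · -- (b) `1 / P(q^{-t} q^{-s})` is a Laurent combination of zeta integrals
    choose Q' hQ' hQQ' using fun i => (hQ i).exists_shift hq0 t
    have h3 := eventually_rightHalfPlanes_add (eventually_eval_qpow_ne_zero hq hP0) t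
    obtain ⟨c₂, hc₂⟩ := eventually_rightHalfPlanes_iff.1 h3
    refine ⟨k, Λ, Λ', v, v', Q', hΛ,
      fun i => by rw [whittakerFunctionals_eq_top_of_fin_one]; exact Submodule.mem_top, hQ',
      max c₂ (c₀ - t.re), fun s hs => ?_⟩
    have hs₀ : c₀ < (s + t).re := by
      rw [Complex.add_re]
      linarith [le_max_right c₂ (c₀ - t.re)]
    have key := hc₀ (s + t) hs₀
    simp only at key ⊢
    rw [evalAtQ_rsLRat_comp_C_mul_X hq0 P t s (hc₂ s ((le_max_left _ _).trans_lt hs)), ← key]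
    exact Finset.sum_congr rfl fun i _ => by rw [hQQ', hZ]

/-- **`L(s, π × |·|^t) = L(s + t, π × 1)`** (`GL_n × GL₁`): for `χ(a) = |a|^t`,
`P(q^{-t} X)` is an `L`-polynomial of `(π, χ)` iff `P` is an `L`-polynomial of `(π, 1)`, i.e.
`L(s, π × χ) = P(q^{-(s+t)})⁻¹ = L(s + t, π × 1)` (Jacquet–Langlands 1970, p. 40; in the proof of
Thm. 11.1, p. 171, for `χ = |η_v|^{-1/2}`). [cite: JacquetLanglands1970, p. 40 and proof of Thm. 11.1, p. 171] -/
theorem hasRSLFactor_glOneRep_iff_of_normAbs_cpow (hn : 1 < n) {V : Type*} [AddCommGroup V]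
    [Module ℂ V] (π : Representation ℂ (GL (Fin n) F) V) (ψ : AddChar F Circle)
    (ν : Measure (GL (Fin 1) F ⧸ upperUnitriangular (Fin 1) F)) {χ : Fˣ →* ℂˣ} {t : ℂ}
    (hχ : ∀ a : Fˣ, ((χ a : ℂˣ) : ℂ) = (((normAbs F (a : F) : ℝ≥0) : ℝ) : ℂ) ^ t) (P : ℂ[X]) :
    HasRSLFactor hn π (glOneRep χ) ψ ν (P.comp (C (((residueFieldCard F : ℕ) : ℂ) ^ (-t)) * X)) ↔
      HasRSLFactor hn π (Representation.trivial ℂ (GL (Fin 1) F) ℂ) ψ ν P := by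
  have hq0 : 0 < residueFieldCard F := zero_lt_one.trans (one_lt_residueFieldCard F)
  constructor
  · intro h
    have h' := HasRSLFactor.of_rsZeta_eq_add hn (π₁ := glOneRep χ)
      (π₂ := Representation.trivial ℂ (GL (Fin 1) F) ℂ) (t := -t)
      (fun W Λ' v' s => by
        rw [rsZeta_glOneRep_eq_rsZeta_trivial_add hn ν hχ, show s + -t + t = s by ring]) h
    rwa [comp_C_mul_X_comp_C_mul_X, rsShift_qpow_mul_qpow_neg hq0, C_1, one_mul,
      comp_X] at h'
  · exact fun h => HasRSLFactor.of_rsZeta_eq_add hn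
      (fun W Λ' v' s => rsZeta_glOneRep_eq_rsZeta_trivial_add hn ν hχ W Λ' v' s) h

/-- **`L(s, (π ⊗ |det|^t) × 1) = L(s + t, π × 1)`** for `GL₂`: if `χ(a) = |a|^t` and
`c = χ ∘ det`, then `P(q^{-t} X)` is an `L`-polynomial of `(π ⊗ c, 1)` iff `P` is an
`L`-polynomial of `(π, 1)` (`hasRSLFactor_glOneRep_iff_twist` of `GL2RSLFactorCharacter` and
`hasRSLFactor_glOneRep_iff_of_normAbs_cpow`).  Jacquet–Langlands 1970, proof of Thm. 11.1,
p. 171: the local factors of `|η(det)|^{-1/2} ⊗ π` are those of `π` shifted. [cite: JacquetLanglands1970, proof of Thm. 11.1, p. 171] -/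
theorem hasRSLFactor_twist_det_iff_of_normAbs_cpow {V : Type*} [AddCommGroup V] [Module ℂ V]
    (π : Representation ℂ (GL (Fin 2) F) V) (ψ : AddChar F Circle)
    (ν : Measure (GL (Fin 1) F ⧸ upperUnitriangular (Fin 1) F)) {χ : Fˣ →* ℂˣ} {t : ℂ}
    (hχ : ∀ a : Fˣ, ((χ a : ℂˣ) : ℂ) = (((normAbs F (a : F) : ℝ≥0) : ℝ) : ℂ) ^ t)
    {c : GL (Fin 2) F →* ℂˣ} (hc : ∀ g, c g = χ (Matrix.GeneralLinearGroup.det g)) (P : ℂ[X]) :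
    HasRSLFactor Nat.one_lt_two (π.twist c) (Representation.trivial ℂ (GL (Fin 1) F) ℂ) ψ ν
        (P.comp (C (((residueFieldCard F : ℕ) : ℂ) ^ (-t)) * X)) ↔
      HasRSLFactor Nat.one_lt_two π (Representation.trivial ℂ (GL (Fin 1) F) ℂ) ψ ν P := by
  rw [← hasRSLFactor_glOneRep_iff_twist π ν hc ψ, hasRSLFactor_glOneRep_iff_of_normAbs_cpow _ π ψ ν hχ]

end Local

end Literature.NumberTheory.Automorphic

end
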